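import Summits.Ventures.LatticeQCDFlow.Scaling.SimulatedTemperingLifted

/-!
# Perfect transport maps make the lifted sampler rejection-free and its level walk ballistic

Chapter H of lean-2 GEN-20 (row 31), §11c — the constructive endpoint of the level side.  The lifted exact-weight
simulated-tempering sampler of `Scaling/SimulatedTemperingLifted` advances one level through a transport map
`e_k : S ≃ S` with probability `min{1, μ_{k'}(φx)/μ_k(x)}` and otherwise reverses direction.  If the maps are
PERFECT transports between adjacent couplings,

  `μ_{k+1}(e_k u) = μ_k(u)` for every `k < K` and every `u`,

then every interior advance is accepted (`stLiftAcc = 1`), the level move is DETERMINISTIC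
(`stLiftLevel_apply_of_transport`), and a walker started at the bottom heading up is at level `n` with its
configuration transported along the ladder after exactly `n ≤ K` level moves (`stLiftLevel_pow_bottom_of_transport`,
`stLiftLevel_pow_bottom_level`): the ladder of `K+1` couplings is traversed in `K` level moves.  This is the order the
reversibility-free ballistic floor `Scaling/LevelSchemeBallisticFloor` (`3K ≤ 4n + 1` for every level scheme rising one
level per step) permits, attained; the reversible Metropolis level move with the same perfect maps is a symmetric
random walk on the ladder and needs order `K²` moves (`Scaling/AdjacentLevelSchemeDiffusiveCeiling`).

NOT CLAIMED: any total-variation mixing statement (the pure lifted move with perfect maps is a deterministic cycle of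
length `2(K+1)` and is periodic; mixing needs the within-level updates), anything for imperfect maps beyond
`Scaling/SimulatedTemperingLiftedFloors`, anything measured.  Literature grade (cell rule): KNOWN MECHANISM (lifting /
persistent level walks: Diaconis–Holmes–Neal 2000, Sakai–Hukushima 2016), NEW TYPING; nothing cited as a fact; no bib keys.
-/

noncomputable section

open Finset Function

namespace Summit.Ventures.LatticeQCDFlow.Scaling

variable {S : Type*} [Fintype S] [DecidableEq S] {K : ℕ} {μ : Fin (K + 1) → S → ℝ} {e : Fin (K + 1) → S ≃ S}

/-! ## §1 Perfect transport: every interior advance is accepted -/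

omit [Fintype S] [DecidableEq S] in
/-- Going up from an interior level `k` (`k+1 ≤ K`) the walker tries to enter `k+1`. [ours] -/
theorem stLiftNext_true_of_lt (k : Fin (K + 1)) (hk : (k : ℕ) + 1 < K + 1) :
    stLiftNext k true = ⟨k + 1, hk⟩ := by
  simp only [stLiftNext, hk, dite_true]

omit [Fintype S] [DecidableEq S] in
/-- Going down from a level `k > 0` the walker tries to enter `k-1`. [ours] -/
theorem stLiftNext_false_of_pos (k : Fin (K + 1)) (hk : 0 < (k : ℕ)) :
    stLiftNext k false = ⟨k - 1, by omega⟩ := by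
  simp only [stLiftNext, hk, dite_true]

omit [Fintype S] [DecidableEq S] in
/-- **PERFECT TRANSPORT ⇒ ACCEPTANCE ONE:** if `μ_{k+1} ∘ e_k = μ_k` for every `k < K`, every advance that has a level
to enter is accepted with probability `1` (up: `μ_{k+1}(e_k x) = μ_k(x)`; down: `μ_{k-1}(e_{k-1}⁻¹ x) = μ_k(x)`). [ours] -/
theorem stLiftAcc_eq_one_of_transport (hμ : ∀ k x, 0 < μ k x)
    (he : ∀ (k : Fin (K + 1)) (hk : (k : ℕ) + 1 < K + 1) (u : S), μ ⟨k + 1, hk⟩ (e k u) = μ k u)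
    (p : Fin (K + 1) × (S × Bool)) (hp : stLiftNext p.1 p.2.2 ≠ p.1) : stLiftAcc μ e p = 1 := by
  obtain ⟨k, x, σ⟩ := p
  simp only [stLiftAcc, hp, if_false]
  have hratio : μ (stLiftNext k σ) (stLiftMap e k σ x) / μ k x = 1 := by
    rw [div_eq_one_iff_eq (hμ k x).ne']
    cases σ with
    | true =>
      by_cases hk : (k : ℕ) + 1 < K + 1
      · rw [stLiftNext_true_of_lt k hk]
        exact he k hk x
      · exact absurd (by simp only [stLiftNext, hk, dite_false]) hp
    | false =>
      by_cases hk : 0 < (k : ℕ)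
      · have hnext := stLiftNext_false_of_pos k hk
        have hk' : ((⟨k - 1, by omega⟩ : Fin (K + 1)) : ℕ) + 1 < K + 1 := by simp only; omega
        have hsucc : (⟨(k : ℕ) - 1 + 1, hk'⟩ : Fin (K + 1)) = k := Fin.ext (by simp only; omega)
        have h := he ⟨k - 1, by omega⟩ hk' ((e ⟨k - 1, by omega⟩).symm x)
        rw [Equiv.apply_symm_apply, hsucc] at h
        rw [hnext]
        show μ ⟨k - 1, _⟩ ((e (stLiftNext k false)).symm x) = μ k x
        rw [hnext]; exact h.symm
      · exact absurd (by simp only [stLiftNext, hk, dite_false]) hp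
  rw [hratio, min_self]

omit [Fintype S] in
/-- **THE LEVEL MOVE IS DETERMINISTIC UNDER PERFECT TRANSPORT:** from `p` it goes surely to the advanced state if there
is a level to enter, and surely reverses direction at the two ends of the ladder. [ours] -/
theorem stLiftLevel_apply_of_transport (hμ : ∀ k x, 0 < μ k x)
    (he : ∀ (k : Fin (K + 1)) (hk : (k : ℕ) + 1 < K + 1) (u : S), μ ⟨k + 1, hk⟩ (e k u) = μ k u)
    (p q : Fin (K + 1) × (S × Bool)) :
    stLiftLevel μ e p q
      = if q = (if stLiftNext p.1 p.2.2 = p.1 then stLiftFlip p else stLiftAdv e p) then 1 else 0 := by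
  unfold stLiftLevel
  by_cases hp : stLiftNext p.1 p.2.2 = p.1
  · have h0 : stLiftAcc μ e p = 0 := by simp only [stLiftAcc, hp, if_true]
    simp only [h0, hp, if_true, sub_zero, ite_self, zero_add]
  · have h1 := stLiftAcc_eq_one_of_transport hμ he p hp
    simp only [h1, hp, if_false, sub_self, ite_self, add_zero]

/-! ## §2 Ballistic traversal from the bottom -/

omit [Fintype S] [DecidableEq S] in
/-- The `n`-fold transported configuration along the ladder: `E_0 = id`, `E_{n+1} = e_n ∘ E_n`. (A local recursion on
`ℕ`, used only to name the support point; stated through `Nat.rec` to keep this file definition-free.) [ours] -/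
theorem stLift_transport_iterate_succ (x : S) (n : ℕ) (hn : n < K + 1) :
    (Nat.rec (motive := fun _ => S) x (fun m y => if hm : m < K + 1 then e ⟨m, hm⟩ y else y) (n + 1) : S)
      = e ⟨n, hn⟩ (Nat.rec (motive := fun _ => S) x (fun m y => if hm : m < K + 1 then e ⟨m, hm⟩ y else y) n) := by
  simp only [hn, dite_true]

/-- **BALLISTIC TRAVERSAL:** under perfect transport, after `n ≤ K` level moves a walker started at `(0, x, up)` is
SURELY at level `n`, heading up, with configuration `e_{n-1} ∘ ⋯ ∘ e_0 (x)`. [ours] -/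
theorem stLiftLevel_pow_bottom_of_transport (hμ : ∀ k x, 0 < μ k x)
    (he : ∀ (k : Fin (K + 1)) (hk : (k : ℕ) + 1 < K + 1) (u : S), μ ⟨k + 1, hk⟩ (e k u) = μ k u)
    (x : S) (n : ℕ) (hn : n < K + 1) (q : Fin (K + 1) × (S × Bool)) :
    (stLiftLevel μ e ^ n) ((0 : Fin (K + 1)), (x, true)) q
      = if q = (⟨n, hn⟩, (Nat.rec (motive := fun _ => S) x
          (fun m y => if hm : m < K + 1 then e ⟨m, hm⟩ y else y) n, true)) then 1 else 0 := by
  induction n generalizing q with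
  | zero =>
    have hpt : ((⟨0, hn⟩ : Fin (K + 1)), (Nat.rec (motive := fun _ => S) x
        (fun m y => if hm : m < K + 1 then e ⟨m, hm⟩ y else y) 0, true)) = ((0 : Fin (K + 1)), (x, true)) :=
      Prod.ext (Fin.ext (by simp only [Fin.val_zero])) rfl
    rw [pow_zero, Matrix.one_apply, hpt]
    by_cases h : ((0 : Fin (K + 1)), (x, true)) = q
    · rw [if_pos h, if_pos h.symm]
    · rw [if_neg h, if_neg (Ne.symm h)]
  | succ m ih =>
    have hm : m < K + 1 := by omega
    rw [pow_succ, Matrix.mul_apply]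
    simp only [ih hm, ite_mul, one_mul, zero_mul, Finset.sum_ite_eq', Finset.mem_univ, if_true]
    rw [stLiftLevel_apply_of_transport hμ he]
    have hnext : stLiftNext (⟨m, hm⟩ : Fin (K + 1)) true = ⟨m + 1, hn⟩ := stLiftNext_true_of_lt _ hn
    have hne : (⟨m + 1, hn⟩ : Fin (K + 1)) ≠ ⟨m, hm⟩ := fun h => by simp only [Fin.mk.injEq] at h; omega
    simp only [hnext, hne, if_false, stLiftAdv, stLiftMap, stLift_transport_iterate_succ x m hm]

/-- **THE LEVEL AFTER `n ≤ K` MOVES IS `n`, SURELY** — the law of the level coordinate started from the bottom heading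
up is the point mass at `n`: `Σ_q (L^n)((0,x,↑), q)·f(level q) = f(n)` for every `f`.  `K+1` couplings are traversed in
`K` level moves — the order permitted by `LevelSchemeBallisticFloor` (`3K ≤ 4n + 1`), attained. [ours] -/
theorem stLiftLevel_pow_bottom_level (hμ : ∀ k x, 0 < μ k x)
    (he : ∀ (k : Fin (K + 1)) (hk : (k : ℕ) + 1 < K + 1) (u : S), μ ⟨k + 1, hk⟩ (e k u) = μ k u)
    (x : S) (n : ℕ) (hn : n < K + 1) (f : Fin (K + 1) → ℝ) :
    ∑ q, (stLiftLevel μ e ^ n) ((0 : Fin (K + 1)), (x, true)) q * f q.1 = f ⟨n, hn⟩ := by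
  simp only [stLiftLevel_pow_bottom_of_transport hμ he x n hn, ite_mul, one_mul, zero_mul, Finset.sum_ite_eq',
    Finset.mem_univ, if_true]

/-- **IN PARTICULAR THE TOP IS REACHED IN EXACTLY `K` LEVEL MOVES** (probability one). [ours] -/
theorem stLiftLevel_pow_bottom_top (hμ : ∀ k x, 0 < μ k x)
    (he : ∀ (k : Fin (K + 1)) (hk : (k : ℕ) + 1 < K + 1) (u : S), μ ⟨k + 1, hk⟩ (e k u) = μ k u) (x : S) :
    ∑ q, (stLiftLevel μ e ^ K) ((0 : Fin (K + 1)), (x, true)) q * (if q.1 = Fin.last K then (1 : ℝ) else 0) = 1 := by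
  rw [stLiftLevel_pow_bottom_level hμ he x K (Nat.lt_succ_self K) (fun k => if k = Fin.last K then (1 : ℝ) else 0)]
  simp only [Fin.last, if_true]

end Summit.Ventures.LatticeQCDFlow.Scaling
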